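import Summits.QuantumFields.BalabanUV.Beta.GAN24.TaylorTrilinearDiffSummed
import Summits.QuantumFields.BalabanUV.Beta.GAN24.TaylorTrilinearTransportBound

/-!
# `BalabanUV.Beta.GAN24.TaylorTrilinearDiff` — binder row G-an2-4 ∕ (CONV-C), S-slot, road «S3-Taylor», DIFF row R3-dW:
# generic leaf, PART 7 of 7 — **`trilinear_diff_bound`**: THE TWO-LEVEL DIFFERENCE OF THE WILSON-CHANNEL UNIT SANDWICH
# (the «separate leaf» announced in `GAN24/TaylorTrilinear` for «E3SupRate»'s row dW)

G-an2-4 formalisation swarm, leaf prover 15 (unit `b2b-balaban-gan24-formalise-leaf-15`, gen 14; DIFF row R3-dW holder, INTENT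
CLAIMS.log l.4908).  HONEST FRAMING (cell rule, verbatim): «discharging `BetaPertH` makes Bałaban's UV stability UNCONDITIONAL — a
real constructive-QFT result; it is NOT the continuum limit and NOT the Clay problem.»  HONEST DEPENDENCY (verbatim): «continuum YM
on T⁴ ⇐ BetaPertH ∧ nine spine estimates (0/9 proved); BetaPertH ⇐ (D1) ∧ (D4) ∧ CAP+tail; G-an2-4 gates asym, D1 and NE2/3/4.»
NOT IN PRINT; OUR BOOKKEEPING ([folklore]): elementary real analysis ∕ finite algebra on `ℤ^{d+1}`, GENERIC `d`, GENERIC blockings,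
ABSTRACT legs and table; NO object of an2's typed `U = 1` system occurs, nothing is cited, no `def … : Prop`, NOTHING is asserted
or discharged of «E3Shape»∕«E3SupRate» (OPEN, not in print), of (hS, hSall), of the K-slot, of `BetaPertH`.
NOT BetaPertH, NOT continuum, NOT Clay.

CONTEXT (asserted nowhere below).  The RATE table of the S-slot (`GAN24/StencilSlotE3RateOfPieces.e3SupRate_of_pieces`,
row owner gan24-p1) has the DIFFERENCE row R3-dW: the Wilson piece of the normalised third jet at member `n+3` (blocking
`N′ = N·Lc`) minus the one at member `n+2` (blocking `N`), `≤ cW·θ^{n+1}`.  By `E3UnitSplit.e3W_unit_split` both are (at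
`d = 3`, residual `1`) the SAME unit sandwich functional — three legs, one block average, ONE explicit factor of the blocking
on the SAME translation-invariant zero-row-sum table `wilsonA` — read at two blockings.  This chain of generic leaves
(`TaylorTrilinearCarry` ∕ `…Pairing` ∕ `…DiffSlices` ∕ `…DiffSummed` ∕ `…Transport` ∕ `…TransportBound` ∕ `…Diff`) proves the
two-level difference bound `TaylorTrilinearDiff.trilinear_diff_bound`: TRANSPORT the level-`N` legs to the finer lattice by
`quo Lc` (piecewise constant on cells), split trilinearly — the couplings «(N1-Cauchy)» enter BY THEIR SUP ONLY thanks to ONE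
ABEL SUMMATION in the vertex location — and compare the transported functional with the original one EXACTLY through the
CARRY TABLE of a cell (Hermite's identity: same row sum, same first moments ⇒ second order ⇒ `O(1/N)` by the pairing lemma).

## What is proved ([folklore], `0 sorry`)
* `abs_tsum_slice_sub_transport_le` — `(I)`: level-`N′` functional at the level-`N′` legs minus at the TRANSPORTED level-`N` legs:
  `[(d+1)³|B|²C_T Zl(δ/2)]·[ε_G R e^{3δR}(C′₁H C₁K + 2C₁H C′₁K) + ε_H R e^{2δR}(L C′_G C₁K + C_G C′₁K) + ε_K R e^{3δR}(L C′_H C_G + 2C_H L C′_G)]·E`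
  (the unit gradient of `G₁` is NOT needed: the `w`-site difference enters by its sup).
* **`trilinear_diff_bound`** — `(I) + (II)` in the VERBATIM nesting of `E3UnitSplit.e3W_unit_split` at the two blockings `N′ = L·N`
  and `N` (weights `((N′:ℝ)^(d+1))⁻¹, (N′:ℝ)` resp. `((N:ℝ)^(d+1))⁻¹, (N:ℝ)`): hypotheses = block-label decay + unit gradients of
  `G K H` at blocking `N` and of `K₁ H₁` at blocking `N′`, the COUPLINGS `|G₁ l w − G l (quo L w)| ≤ ε_G e^{−δ|quo N′ w − x′|₁}` (and
  `K`, `H`) — the POINTWISE-SAMPLE form of «(N1-Cauchy)» (owner's `N1-CAUCHY-SPEC.md` §1: equivalent to the cell-mean form given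
  (N1′)) —, the table's finite range `B` (`|·|₁ ≤ R`), bound `C_T`, zero row sums and translation invariance; conclusion
  `|SANDWICH_{N′} − SANDWICH_N| ≤ [(d+1)³|B|²C_T Zl(δ/2)]·[(I)-bracket + (1/N)·(L+1)R²e^{2δR}((C′_H C_G + C_H C′_G)C′_K + (C′_H C_K + C_H C′_K)C′_G + C_H C′_G C′_K)]·E`.
NOT HERE: the instantiation at an2's objects (`G := N^{d+2}GamΦ_N`, `H = K := N^{d+2}wH_N` at the two members, `T := wilsonA`,
`L := Lc`, the prefactor `−cE/Lc^{d+1}` and the residual `N^{d−3} = 1` at `d = 3`), i.e. the ROW FILE of R3-dW (waits on the RATE END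
`StencilSlotE3RateOfPieces` and on «(N1-Cauchy)» BY NAME); «E3SupRate» itself; anything about the other DIFF rows.
-/

noncomputable section

open Finset
open scoped BigOperators
open Literature.MathematicalPhysics.QuantumFieldTheory Balaban1983to89 Balaban1983to89.Beta
open B12Sec2to5 (l1 l1_nonneg)
open ExpKernelCalculus (Zl)
open LatticeForm (quo)

namespace Summit.QuantumFields.BalabanUV.Beta.GAN24.TaylorTrilinearDiff

open Summit.QuantumFields.BalabanUV.Beta.GAN24.TaylorTrilinearLattice
open Summit.QuantumFields.BalabanUV.Beta.GAN24.TaylorTrilinear (nonneg_of_abs_le_mul_exp abs_le_of_abs_le_mul_exp)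
open Summit.QuantumFields.BalabanUV.Beta.GAN24.TaylorTrilinearCarry
open Summit.QuantumFields.BalabanUV.Beta.GAN24.TaylorTrilinearDiffSlices
open Summit.QuantumFields.BalabanUV.Beta.GAN24.TaylorTrilinearDiffSummed
open Summit.QuantumFields.BalabanUV.Beta.GAN24.TaylorTrilinearTransportBound

variable {d : ℕ}

section Main

variable (N L N' : ℕ) [NeZero N] [NeZero L] [NeZero N'] (G K H G₁ K₁ H₁ : Fin (d + 1) → (Fin (d + 1) → ℤ) → ℝ)
  (T : Fin (d + 1) → (Fin (d + 1) → ℤ) → (Fin (d + 1) → ℤ) → (Fin (d + 1) → ℤ) → Fin (d + 1) → Fin (d + 1) → ℝ)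
  (B : Finset (Fin (d + 1) → ℤ)) (x' z' u' : Fin (d + 1) → ℤ)
  {δ CG CG' CK CK' CH CH' C₁G C₁G' C₁K C₁K' C₁H C₁H' εG εK εH CT : ℝ} {R : ℕ}

/-- [folklore] **`(I)` — THE LEVEL-`N′` FUNCTIONAL AT THE LEVEL-`N′` LEGS VERSUS AT THE TRANSPORTED LEVEL-`N` LEGS.**  Trilinear
split into three one-difference-leg slices; the vertex-location difference by W3 verbatim, the two table-site differences by
ONE Abel summation each — the couplings `ε_G, ε_H, ε_K` (sup form) are never differenced. -/
theorem abs_tsum_slice_sub_transport_le (hN' : N' = L * N) (hδ : 0 < δ) (hCG' : 0 ≤ CG') (hCH' : 0 ≤ CH')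
    (hC₁K' : 0 ≤ C₁K') (hC₁H' : 0 ≤ C₁H')
    (hG : ∀ l w, |G l w| ≤ CG * Real.exp (-δ * l1 (quo N w - x')))
    (hG' : ∀ l w j, |G l (w + Pi.single j 1) - G l w| ≤ CG' / N * Real.exp (-δ * l1 (quo N w - x')))
    (hH : ∀ κ v, |H κ v| ≤ CH * Real.exp (-δ * l1 (quo N v - u')))
    (hH' : ∀ κ v j, |H κ (v + Pi.single j 1) - H κ v| ≤ CH' / N * Real.exp (-δ * l1 (quo N v - u')))
    (hK₁ : ∀ l y, |K₁ l y| ≤ C₁K * Real.exp (-δ * l1 (quo N' y - z')))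
    (hK₁' : ∀ l y j, |K₁ l (y + Pi.single j 1) - K₁ l y| ≤ C₁K' / N' * Real.exp (-δ * l1 (quo N' y - z')))
    (hH₁ : ∀ κ v, |H₁ κ v| ≤ C₁H * Real.exp (-δ * l1 (quo N' v - u')))
    (hH₁' : ∀ κ v j, |H₁ κ (v + Pi.single j 1) - H₁ κ v| ≤ C₁H' / N' * Real.exp (-δ * l1 (quo N' v - u')))
    (hGc : ∀ l w, |G₁ l w - G l (quo L w)| ≤ εG * Real.exp (-δ * l1 (quo N' w - x')))
    (hKc : ∀ l y, |K₁ l y - K l (quo L y)| ≤ εK * Real.exp (-δ * l1 (quo N' y - z')))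
    (hHc : ∀ κ v, |H₁ κ v - H κ (quo L v)| ≤ εH * Real.exp (-δ * l1 (quo N' v - u')))
    (hB : ∀ s ∈ B, LatticeForm.l1 s ≤ R) (hT0 : ∀ κ v w y l l', |T κ v w y l l'| ≤ CT)
    (hTsum : ∀ κ v l l', ∑ s ∈ B, ∑ t ∈ B, T κ v (v + s) (v + t) l l' = 0)
    (hTinv : ∀ κ v s t l l', T κ v (v + s) (v + t) l l' = T κ 0 s t l l') :
    |∑' u, slice (((N' : ℝ) ^ (d + 1))⁻¹) N' G₁ K₁ H₁ T B u -
        ∑' u, slice (((N' : ℝ) ^ (d + 1))⁻¹) N' (fun l w => G l (quo L w)) (fun l' y => K l' (quo L y))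
          (fun κ u => H κ (quo L u)) T B u| ≤
      (((d : ℝ) + 1) ^ 3 * (B.card : ℝ) ^ 2 * CT * Zl (d + 1) (δ / 2)) *
        (εG * R * Real.exp (3 * δ * R) * (C₁H' * C₁K + 2 * C₁H * C₁K') +
         εH * R * Real.exp (2 * δ * R) * ((L * CG') * C₁K + CG * C₁K') +
         εK * R * Real.exp (3 * δ * R) * ((L * CH') * CG + 2 * CH * (L * CG'))) *
        Real.exp (-(δ / 2) * (l1 (x' - u') + l1 (z' - u'))) := by
  have hN1 : (0 : ℝ) < N' := by exact_mod_cast Nat.pos_of_ne_zero (NeZero.ne N')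
  have hc : (0 : ℝ) ≤ ((N' : ℝ) ^ (d + 1))⁻¹ := by positivity
  -- the transported legs at blocking `N′`
  have hGt : ∀ l w, |G l (quo L w)| ≤ CG * Real.exp (-δ * l1 (quo N' w - x')) := fun l w => transport_decay hN' (hG l) w
  have hGt' : ∀ l w j, |G l (quo L (w + Pi.single j 1)) - G l (quo L w)| ≤ (L * CG') / N' * Real.exp (-δ * l1 (quo N' w - x')) :=
    fun l w j => transport_unit_step hN' hCG' (hG' l) w j
  have hHt : ∀ κ v, |H κ (quo L v)| ≤ CH * Real.exp (-δ * l1 (quo N' v - u')) := fun κ v => transport_decay hN' (hH κ) v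
  have hHt' : ∀ κ v j, |H κ (quo L (v + Pi.single j 1)) - H κ (quo L v)| ≤ (L * CH') / N' * Real.exp (-δ * l1 (quo N' v - u')) :=
    fun κ v j => transport_unit_step hN' hCH' (hH' κ) v j
  -- summability of the five slices involved (three-centre domination, W3's `summable_slice`)
  have hS : ∀ (X Y Z : Fin (d + 1) → (Fin (d + 1) → ℤ) → ℝ) {cX cY cZ : ℝ},
      (∀ l w, |X l w| ≤ cX * Real.exp (-δ * l1 (quo N' w - x'))) → (∀ κ v, |Z κ v| ≤ cZ * Real.exp (-δ * l1 (quo N' v - u'))) →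
      (∀ l y, |Y l y| ≤ cY * Real.exp (-δ * l1 (quo N' y - z'))) →
      Summable fun u => slice (((N' : ℝ) ^ (d + 1))⁻¹) N' X Y Z T B u :=
    fun X Y Z cX cY cZ hX hZ hY => summable_sum fun t _ => summable_sum fun s _ =>
      TaylorTrilinear.summable_slice N' X Y Z T x' z' u' hc hN1.le hδ hX hZ hY hT0 t s
  have hDG : ∀ l w, |(fun l w => G₁ l w - G l (quo L w)) l w| ≤ εG * Real.exp (-δ * l1 (quo N' w - x')) := hGc
  have hDK : ∀ l y, |(fun l' y => K₁ l' y - K l' (quo L y)) l y| ≤ εK * Real.exp (-δ * l1 (quo N' y - z')) := hKc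
  have hDH : ∀ κ v, |(fun κ v => H₁ κ v - H κ (quo L v)) κ v| ≤ εH * Real.exp (-δ * l1 (quo N' v - u')) := hHc
  -- decay of `G₁` and of the transported `K`: from the couplings (not needed as hypotheses)
  have hG₁ : ∀ l w, |G₁ l w| ≤ (εG + CG) * Real.exp (-δ * l1 (quo N' w - x')) := by
    intro l w
    calc |G₁ l w| = |(G₁ l w - G l (quo L w)) + G l (quo L w)| := by ring_nf
      _ ≤ |G₁ l w - G l (quo L w)| + |G l (quo L w)| := abs_add_le _ _
      _ ≤ εG * Real.exp (-δ * l1 (quo N' w - x')) + CG * Real.exp (-δ * l1 (quo N' w - x')) := add_le_add (hGc l w) (hGt l w)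
      _ = _ := by ring
  have hKt : ∀ l y, |K l (quo L y)| ≤ (εK + C₁K) * Real.exp (-δ * l1 (quo N' y - z')) := by
    intro l y
    calc |K l (quo L y)| = |K₁ l y - (K₁ l y - K l (quo L y))| := by ring_nf
      _ ≤ |K₁ l y| + |K₁ l y - K l (quo L y)| := abs_sub _ _
      _ ≤ C₁K * Real.exp (-δ * l1 (quo N' y - z')) + εK * Real.exp (-δ * l1 (quo N' y - z')) := add_le_add (hK₁ l y) (hKc l y)
      _ = _ := by ring
  have s1 := hS G₁ K₁ H₁ hG₁ hH₁ hK₁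
  have s2 := hS (fun l w => G l (quo L w)) (fun l' y => K l' (quo L y)) (fun κ u => H κ (quo L u)) hGt hHt hKt
  have sL := hS (fun l w => G₁ l w - G l (quo L w)) K₁ H₁ hDG hH₁ hK₁
  have sM := hS (fun l w => G l (quo L w)) K₁ (fun κ v => H₁ κ v - H κ (quo L v)) hGt hDH hK₁
  have sR := hS (fun l w => G l (quo L w)) (fun l' y => K₁ l' y - K l' (quo L y)) (fun κ u => H κ (quo L u)) hGt hHt hDK
  rw [← s1.tsum_sub s2, tsum_congr fun u => slice_sub_slice _ _ _ _ _ G₁ K₁ H₁ T B u, (sL.add sM).tsum_add sR,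
    sL.tsum_add sM]
  have bL := abs_tsum_slice_left_le N' K₁ H₁ (fun l w => G₁ l w - G l (quo L w)) T B x' z' u' hδ hC₁H' hC₁K' hDG hH₁ hH₁'
    hK₁ hK₁' hB hT0 hTsum hTinv
  have bM := abs_tsum_slice_mid_le N' (fun l w => G l (quo L w)) K₁ (fun κ v => H₁ κ v - H κ (quo L v)) T B x' z' u' hδ
    hGt hGt' hDH hK₁ hK₁' hB hT0 hTsum
  have bR := abs_tsum_slice_right_le N' (fun l w => G l (quo L w)) (fun κ u => H κ (quo L u))
    (fun l' y => K₁ l' y - K l' (quo L y)) T B x' z' u' hδ (by positivity) (by positivity) hGt hGt' hHt hHt' hDK hB hT0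
    hTsum hTinv
  refine (abs_add_le _ _).trans ((add_le_add ((abs_add_le _ _).trans (add_le_add bL bM)) bR).trans (le_of_eq ?_))
  ring

/-- [folklore] **`trilinear_diff_bound` — THE TWO-LEVEL DIFFERENCE OF THE WILSON-CHANNEL UNIT SANDWICH** (the generic
leaf of the DIFF row R3-dW of «E3SupRate»; the «separate leaf» announced in `GAN24/TaylorTrilinear`).  In the VERBATIM nesting of
`E3UnitSplit.e3W_unit_split` (as in W3 `TaylorTrilinear.trilinear_taylor_bound`), the sandwich at blocking `N′ = L·N` with legs
`G₁ K₁ H₁` minus the sandwich at blocking `N` with legs `G K H` — SAME table `T` (finite range `B`, zero row sums, translation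
invariant), SAME coarse centres `x′ z′ u′` — is bounded by
`[(d+1)³|B|²·C_T·Zl(δ/2)]·[ε_G·R·e^{3δR}(C′₁H C₁K + 2C₁H C′₁K) + ε_H·R·e^{2δR}(L C′_G C₁K + C_G C′₁K) + ε_K·R·e^{3δR}(L C′_H C_G + 2 C_H L C′_G)
   + (1/N)·(L+1)·R²·e^{2δR}·((C′_H C_G + C_H C′_G)C′_K + (C′_H C_K + C_H C′_K)C′_G + C_H C′_G C′_K)]·e^{−(δ/2)(|x′−u′|₁+|z′−u′|₁)}`
under: block-label decay + UNIT GRADIENTS of all three legs at blocking `N` ((N1)+(N1′) at the coarse level), decay of `K₁ H₁` and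
unit gradients of `K₁ H₁` at blocking `N′`, and the COUPLINGS `|G₁ l w − G l (quo L w)| ≤ ε_G·e^{−δ|quo N′ w − x′|₁}` etc. — the
POINTWISE-SAMPLE form of «(N1-Cauchy)» — which enter by their SUP only (one Abel summation in the vertex location, never a
gradient of a difference).  NOT a statement about any object of an2's system; the DIFF row R3-dW is this bound instantiated
(row file, d = 3, residual `N^{d−3} = 1` at both levels). -/
theorem trilinear_diff_bound (hN' : N' = L * N) (hδ : 0 < δ) (hCG' : 0 ≤ CG') (hCK' : 0 ≤ CK') (hCH' : 0 ≤ CH')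
    (hC₁K' : 0 ≤ C₁K') (hC₁H' : 0 ≤ C₁H')
    (hG : ∀ l w, |G l w| ≤ CG * Real.exp (-δ * l1 (quo N w - x')))
    (hG' : ∀ l w j, |G l (w + Pi.single j 1) - G l w| ≤ CG' / N * Real.exp (-δ * l1 (quo N w - x')))
    (hK : ∀ l y, |K l y| ≤ CK * Real.exp (-δ * l1 (quo N y - z')))
    (hK' : ∀ l y j, |K l (y + Pi.single j 1) - K l y| ≤ CK' / N * Real.exp (-δ * l1 (quo N y - z')))
    (hH : ∀ κ v, |H κ v| ≤ CH * Real.exp (-δ * l1 (quo N v - u')))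
    (hH' : ∀ κ v j, |H κ (v + Pi.single j 1) - H κ v| ≤ CH' / N * Real.exp (-δ * l1 (quo N v - u')))
    (hK₁ : ∀ l y, |K₁ l y| ≤ C₁K * Real.exp (-δ * l1 (quo N' y - z')))
    (hK₁' : ∀ l y j, |K₁ l (y + Pi.single j 1) - K₁ l y| ≤ C₁K' / N' * Real.exp (-δ * l1 (quo N' y - z')))
    (hH₁ : ∀ κ v, |H₁ κ v| ≤ C₁H * Real.exp (-δ * l1 (quo N' v - u')))
    (hH₁' : ∀ κ v j, |H₁ κ (v + Pi.single j 1) - H₁ κ v| ≤ C₁H' / N' * Real.exp (-δ * l1 (quo N' v - u')))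
    (hGc : ∀ l w, |G₁ l w - G l (quo L w)| ≤ εG * Real.exp (-δ * l1 (quo N' w - x')))
    (hKc : ∀ l y, |K₁ l y - K l (quo L y)| ≤ εK * Real.exp (-δ * l1 (quo N' y - z')))
    (hHc : ∀ κ v, |H₁ κ v - H κ (quo L v)| ≤ εH * Real.exp (-δ * l1 (quo N' v - u')))
    (hB : ∀ s ∈ B, LatticeForm.l1 s ≤ R) (hT0 : ∀ κ v w y l l', |T κ v w y l l'| ≤ CT)
    (hTw : ∀ κ u w y l l', w - u ∉ B → T κ u w y l l' = 0)
    (hTy : ∀ κ u w y l l', y - u ∉ B → T κ u w y l l' = 0)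
    (hTsum : ∀ κ v l l', ∑ s ∈ B, ∑ t ∈ B, T κ v (v + s) (v + t) l l' = 0)
    (hTinv : ∀ κ v s t l l', T κ v (v + s) (v + t) l l' = T κ 0 s t l l') :
    |(∑' y : Fin (d + 1) → ℤ, ∑ l' : Fin (d + 1),
        (∑' w : Fin (d + 1) → ℤ, ∑ l : Fin (d + 1), G₁ l w *
            ∑ κ : Fin (d + 1), ((N' : ℝ) ^ (d + 1))⁻¹ * ∑' u : Fin (d + 1) → ℤ, H₁ κ u * ((N' : ℝ) * T κ u w y l l')) *
          K₁ l' y) -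
      (∑' y : Fin (d + 1) → ℤ, ∑ l' : Fin (d + 1),
        (∑' w : Fin (d + 1) → ℤ, ∑ l : Fin (d + 1), G l w *
            ∑ κ : Fin (d + 1), ((N : ℝ) ^ (d + 1))⁻¹ * ∑' u : Fin (d + 1) → ℤ, H κ u * ((N : ℝ) * T κ u w y l l')) *
          K l' y)| ≤
      (((d : ℝ) + 1) ^ 3 * (B.card : ℝ) ^ 2 * CT * Zl (d + 1) (δ / 2)) *
        (εG * R * Real.exp (3 * δ * R) * (C₁H' * C₁K + 2 * C₁H * C₁K') +
         εH * R * Real.exp (2 * δ * R) * ((L * CG') * C₁K + CG * C₁K') +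
         εK * R * Real.exp (3 * δ * R) * ((L * CH') * CG + 2 * CH * (L * CG')) +
         (1 / N) * (((L : ℝ) + 1) * R ^ 2 * Real.exp (2 * δ * R) *
           ((CH' * CG + CH * CG') * CK' + (CH' * CK + CH * CK') * CG' + CH * CG' * CK'))) *
        Real.exp (-(δ / 2) * (l1 (x' - u') + l1 (z' - u'))) := by
  have hN : (0 : ℝ) < N := by exact_mod_cast Nat.pos_of_ne_zero (NeZero.ne N)
  have hN1 : (0 : ℝ) < N' := by exact_mod_cast Nat.pos_of_ne_zero (NeZero.ne N')
  have hG₁ : ∀ l w, |G₁ l w| ≤ (εG + CG) * Real.exp (-δ * l1 (quo N' w - x')) := by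
    intro l w
    calc |G₁ l w| = |(G₁ l w - G l (quo L w)) + G l (quo L w)| := by ring_nf
      _ ≤ |G₁ l w - G l (quo L w)| + |G l (quo L w)| := abs_add_le _ _
      _ ≤ εG * Real.exp (-δ * l1 (quo N' w - x')) + CG * Real.exp (-δ * l1 (quo N' w - x')) :=
          add_le_add (hGc l w) (transport_decay hN' (hG l) w)
      _ = _ := by ring
  -- Step 0: both sandwiches as lattice sums of slices (`TaylorTrilinearLattice.sandwich_reorder`)
  rw [sandwich_eq_tsum_slice _ _ G₁ K₁ H₁ T B hTw hTy (fun t _ s _ =>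
      TaylorTrilinear.summable_slice N' G₁ K₁ H₁ T x' z' u' (by positivity) hN1.le hδ hG₁ hH₁ hK₁ hT0 t s),
    sandwich_eq_tsum_slice _ _ G K H T B hTw hTy (fun t _ s _ =>
      TaylorTrilinear.summable_slice N G K H T x' z' u' (by positivity) hN.le hδ hG hH hK hT0 t s)]
  -- Step 1: insert the transported legs; (I) + (II)
  have hI := abs_tsum_slice_sub_transport_le N L N' G K H G₁ K₁ H₁ T B x' z' u' hN' hδ hCG' hCH' hC₁K' hC₁H' hG hG' hH hH'
    hK₁ hK₁' hH₁ hH₁' hGc hKc hHc hB hT0 hTsum hTinv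
  have hII := abs_tsum_transport_sub_le N L N' G K H T B x' z' u' hN' hδ hCG' hCK' hCH' hG hG' hK hK' hH hH' hB hT0 hTsum hTinv
  have e : ∀ a b m : ℝ, a - b = (a - m) + (m - b) := fun a b m => by ring
  rw [e _ _ (∑' u, slice (((N' : ℝ) ^ (d + 1))⁻¹) N' (fun l w => G l (quo L w)) (fun l' y => K l' (quo L y))
    (fun κ u => H κ (quo L u)) T B u)]
  refine (abs_add_le _ _).trans ((add_le_add hI hII).trans (le_of_eq ?_))
  ring

end Main

end Summit.QuantumFields.BalabanUV.Beta.GAN24.TaylorTrilinearDiff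

end
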